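import Mathlib
import Literature.Computability.AlgebraicComplexity.MatrixMultiplicationExponent
import HarnessLib

/-!
# Rank of the small matrix multiplication tensors `⟨2,2,2⟩` and `⟨3,3,3⟩` (as printed in Landsberg 2017)

Topic `Computability/AlgebraicComplexity` (bilinear complexity; small formats).

Landsberg, *Geometry and Complexity Theory* (CUP 2017), §1.1.14, p. 20, prints the state of the
art for the two smallest square formats over `ℂ`:
"For `n = 2`, we will see that `R̲(M⟨2⟩) = R(M⟨2⟩) = 7`. … For `n = 3`, we only know
`16 ≤ R̲(M⟨3⟩) ≤ 20` and `19 ≤ R(M⟨3⟩) ≤ 23`."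
(Rank `7`: Strassen 1969 upper bound, Winograd 1971 / Hopcroft–Kerr 1971 lower bound; rank of
`⟨3,3,3⟩`: Laderman 1976 upper bound `23`, Bläser 2003 lower bound `19`.) Only the RANK
statements are vendored here (`tensorRank`, `matMulTensor` of
`Literature.Computability.AlgebraicComplexity`); the border-rank statements are not.

## Why vendored

Small-instance floor for route `Summit.MatrixMultiplication.MatrixMultiplication.Theses.
WindowedCompletionRank` (items `WeylBeatsTrivial`, `WeylCompletion`: a completion of rank `c`
of the clock-and-shift cocycle on `(ℤ_m^k)²` gives `R(⟨m^k⟩) ≤ m^{2k}·c`, so `R(⟨2⟩) = 7 > 4`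
forces `c = 2` at `(m,k) = (2,1)` and `R(⟨3⟩) ≥ 19 > 18` forces `c = 3` at `(3,1)`), and a
reusable anchor for the many `⟨2,2,2⟩` statements in the MatrixMultiplication theses.

## Design notes

* Stated over `ℂ` exactly as printed by Landsberg (whose ground field is `ℂ` throughout).
* `tensorRank` is an `sInf` with junk value `0` only for infinite index types; here the index
  types are finite, and `tensorRank_matMulTensor_le` (proved) already gives `R(⟨n,n,n⟩) ≤ n³`.
-/

namespace Literature.Computability.AlgebraicComplexity

/-- **`R(⟨2,2,2⟩) = 7` over `ℂ`** (Landsberg 2017, §1.1.14, p. 20, as printed: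
"For `n = 2`, we will see that `R̲(M⟨2⟩) = R(M⟨2⟩) = 7`"; Strassen 1969 for `≤ 7`,
Winograd 1971 / Hopcroft–Kerr 1971 for `≥ 7`). Rank statement only.
Grounds the `(m,k) = (2,1)` floor of
`Summit.MatrixMultiplication.MatrixMultiplication.Theses.WindowedCompletionRank.WeylBeatsTrivial`.
[cite: LandsbergGCT2017, §1.1.14 (p. 20)] -/
def LandsbergGCT2017_tensorRank_matMulTensor_two : Prop :=
  tensorRank (matMulTensor ℂ 2 2 2) = 7

/-- **`19 ≤ R(⟨3,3,3⟩) ≤ 23` over `ℂ`** (Landsberg 2017, §1.1.14, p. 20, as printed: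
"For `n = 3`, we only know `16 ≤ R̲(M⟨3⟩) ≤ 20` and `19 ≤ R(M⟨3⟩) ≤ 23`"; Bläser 2003 for
`≥ 19`, Laderman 1976 for `≤ 23`). Rank statement only.
Grounds the `(m,k) = (3,1)` floor of
`Summit.MatrixMultiplication.MatrixMultiplication.Theses.WindowedCompletionRank.WeylBeatsTrivial`.
[cite: LandsbergGCT2017, §1.1.14 (p. 20)] -/
def LandsbergGCT2017_tensorRank_matMulTensor_three : Prop :=
  19 ≤ tensorRank (matMulTensor ℂ 3 3 3) ∧ tensorRank (matMulTensor ℂ 3 3 3) ≤ 23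

/-- Reading the fact: no bilinear algorithm of rank `≤ 18` for `3 × 3` matrices over `ℂ`
(Landsberg 2017, §1.1.14, p. 20). [cite: LandsbergGCT2017, §1.1.14 (p. 20)] -/
theorem not_tensorRank_matMulTensor_three_le_eighteen
    (h : LandsbergGCT2017_tensorRank_matMulTensor_three) :
    ¬ tensorRank (matMulTensor ℂ 3 3 3) ≤ 18 := by
  have h19 := h.1
  omega

end Literature.Computability.AlgebraicComplexity
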